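import Mathlib.ModelTheory.Definability
import Mathlib.Analysis.Analytic.Constructions
import Mathlib.Analysis.Analytic.Linear
import Mathlib.Topology.MetricSpace.Pseudo.Pi
import Literature.ModelTheory.ExponentialFields.RealAnExp
import Literature.ModelTheory.ExponentialFields.OMinimalDefinabilityBlocks
import Literature.Geometry.Manifold.SubanalyticSetsProofs
import HarnessLib

/-!
# Bounded semi-analytic and subanalytic sets are definable in `ℝ_an,exp`

Proof file (theorems only, no new named facts) in the vocabulary of `RealAnExp.lean`
(`Language.realAnExp`, restricted analytic functions `RestrictedAnalytic n` interpreted by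
`RestrictedAnalytic.restrict` = the function on `[0,1]ⁿ`, `0` outside) and of
`Literature/Geometry/Manifold/SubanalyticSets.lean` (Hironaka 1975, Def. 3.1 / Def. 3.3:
`IsSemianalytic`, `IsSubanalytic`, over `IsLocallyInBooleanClosure`).

The point (Pila 2022, 8.21; van den Dries–Miller 1994, Introduction): the sets definable in
`ℝ_an = (ℝ, <, +, ·, {restricted analytic functions})` are the *globally subanalytic* sets; in
particular every BOUNDED semi-analytic or subanalytic subset of `ℝⁿ` is `ℝ_an`-definable, hence
definable in the expansion `ℝ_an,exp` — the easy half of that identification, which is all that is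
proved here (the converse needs Gabrielov's theorem). Mechanism: a function real-analytic on a
neighbourhood of a closed box `[a, b]` is, after the affine change of variables `[0,1]ⁿ → [a,b]`, a
restricted analytic function, so its graph over the box is definable by an atomic formula with real
parameters; a compact subset of an open set is covered by finitely many closed boxes inside the open
set; Hironaka's local Boolean combinations are then globalised over the compact closure of a bounded
set (definable sets being closed under finite Boolean combinations and projections,
van den Dries 1998, Ch. 1 (2.3)).

## Main statements (all proved)

* `Language.realAnExp.definableFun_add/mul/neg/sub/sum/const/restrict` — closure properties of
  `ℝ_an,exp`-definable functions of tuples; `definable_setOf_lt'/le'` (`<`, `≤`);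
  `definable_Icc`, `definable_setOf_comp_mem_Icc` (closed boxes); `definable_biUnion_finset'`.
* `Language.realAnExp.definable_graphOn_Icc` — the graph over a closed box `Icc a b ⊆ U` (`a < b`)
  of a function analytic on the open set `U` is definable.
* `Language.realAnExp.exists_boxes_definable_graphOn` — for `C ⊆ U` compact, `U` open, there is a
  compact definable `D` (a finite union of closed cubes, `exists_Icc_subset_of_isOpen`) with
  `C ⊆ D ⊆ U` over which the graph of EVERY function analytic on `U` is definable;
  `definable_setOf_mem_and_nonneg` (superlevel sets over `D`), `definable_vectorGraphOn` (graphs of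
  vector-valued maps over `D`, in `Fin n ⊕ Fin k` coordinates).
* `Literature.Geometry.Manifold.IsLocallyInBooleanClosure.definable_of_local` — globalisation of
  Hironaka's local Boolean combinations over a compact set.
* `IsSemianalytic.definable_realAnExp`, `definable_image_of_isSemianalytic` (Hironaka's generators
  `f(B)` of Def. 3.3), `IsSubanalytic.definable_realAnExp` (+ `_image`, through a linear
  isomorphism `E ≃ ℝⁿ`) — **bounded semi-analytic, resp. subanalytic, subsets of `ℝⁿ` are definable
  (with parameters) in `ℝ_an,exp`.**

Consumer: the cut locus of a compact real-analytic Riemannian manifold (Buchner 1977), whose tangent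
cut locus is bounded subanalytic (`Riemannian/TangentCutLocusSubanalytic.lean`).

## References

* [Pila2022] J. Pila, *Point-counting and the Zilber–Pink conjecture*, CUP (2022), 8.21 (globally
  subanalytic sets = the `ℝ_an`-definable sets; read in the held copy).
* [VandendriesMiller1994] L. van den Dries, C. Miller, Israel J. Math. 85 (1994), 19–56, Introduction.
* [Dries1998] L. van den Dries, *Tame topology and o-minimal structures* (1998), Ch. 1 (2.3).
* [Hironaka1975] H. Hironaka, Triangulations of algebraic sets, PSPM 29 (1975), Def. 3.1, Def. 3.3.
-/

noncomputable section

open Set FirstOrder FirstOrder.Language Filter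
open _root_.Topology

namespace Literature.ModelTheory.ExponentialFields

namespace Language.realAnExp

/-! ### Definable functions of tuples in `ℝ_an,exp` -/

section DefinableFun

variable {α : Type*}

/-- A binary function symbol applied to two definable functions of tuples is definable. [folklore] -/
theorem definableFun_funMap₂ (F : realAnExpFunc 2) {g h : (α → ℝ) → ℝ}
    (hg : (univ : Set ℝ).DefinableFun Language.realAnExp g)
    (hh : (univ : Set ℝ).DefinableFun Language.realAnExp h) :
    (univ : Set ℝ).DefinableFun Language.realAnExp
      (fun v => Structure.funMap (L := Language.realAnExp) F ![g v, h v]) := by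
  have hF : (univ : Set ℝ).DefinableFun Language.realAnExp
      (Structure.funMap (L := Language.realAnExp) (M := ℝ) F) :=
    (Set.DefinableFun.fun_symbol (L := Language.realAnExp) (M := ℝ) F).of_empty
  have hG : (univ : Set ℝ).DefinableMap Language.realAnExp (fun v => (![g v, h v] : Fin 2 → ℝ)) :=
    Fin.forall_fin_two.2 ⟨by simpa using hg, by simpa using hh⟩
  exact hF.comp hG

/-- A unary function symbol applied to a definable function of tuples is definable. [folklore] -/
theorem definableFun_funMap₁ (F : realAnExpFunc 1) {g : (α → ℝ) → ℝ}
    (hg : (univ : Set ℝ).DefinableFun Language.realAnExp g) :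
    (univ : Set ℝ).DefinableFun Language.realAnExp
      (fun v => Structure.funMap (L := Language.realAnExp) F ![g v]) := by
  have hF : (univ : Set ℝ).DefinableFun Language.realAnExp
      (Structure.funMap (L := Language.realAnExp) (M := ℝ) F) :=
    (Set.DefinableFun.fun_symbol (L := Language.realAnExp) (M := ℝ) F).of_empty
  have hG : (univ : Set ℝ).DefinableMap Language.realAnExp (fun v => (![g v] : Fin 1 → ℝ)) := by
    intro i
    fin_cases i
    simpa using hg
  exact hF.comp hG

/-- Sums of definable functions are definable. [folklore] -/
theorem definableFun_add {g h : (α → ℝ) → ℝ}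
    (hg : (univ : Set ℝ).DefinableFun Language.realAnExp g)
    (hh : (univ : Set ℝ).DefinableFun Language.realAnExp h) :
    (univ : Set ℝ).DefinableFun Language.realAnExp (fun v => g v + h v) := by
  simpa using definableFun_funMap₂ realAnExpFunc.add hg hh

/-- Products of definable functions are definable. [folklore] -/
theorem definableFun_mul {g h : (α → ℝ) → ℝ}
    (hg : (univ : Set ℝ).DefinableFun Language.realAnExp g)
    (hh : (univ : Set ℝ).DefinableFun Language.realAnExp h) :
    (univ : Set ℝ).DefinableFun Language.realAnExp (fun v => g v * h v) := by
  simpa using definableFun_funMap₂ realAnExpFunc.mul hg hh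

/-- Negatives of definable functions are definable. [folklore] -/
theorem definableFun_neg {g : (α → ℝ) → ℝ}
    (hg : (univ : Set ℝ).DefinableFun Language.realAnExp g) :
    (univ : Set ℝ).DefinableFun Language.realAnExp (fun v => -g v) := by
  simpa using definableFun_funMap₁ realAnExpFunc.neg hg

/-- Differences of definable functions are definable. [folklore] -/
theorem definableFun_sub {g h : (α → ℝ) → ℝ}
    (hg : (univ : Set ℝ).DefinableFun Language.realAnExp g)
    (hh : (univ : Set ℝ).DefinableFun Language.realAnExp h) :
    (univ : Set ℝ).DefinableFun Language.realAnExp (fun v => g v - h v) := by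
  simpa [sub_eq_add_neg] using definableFun_add hg (definableFun_neg hh)

/-- Constants are definable functions (parameters from `univ`). [folklore] -/
theorem definableFun_const (c : ℝ) :
    (univ : Set ℝ).DefinableFun Language.realAnExp (fun _ : α → ℝ => c) :=
  definableFun_const' α c

/-- Finite sums of definable functions are definable. [folklore] -/
theorem definableFun_sum {ι : Type*} (s : Finset ι) {g : ι → (α → ℝ) → ℝ}
    (hg : ∀ i ∈ s, (univ : Set ℝ).DefinableFun Language.realAnExp (g i)) :
    (univ : Set ℝ).DefinableFun Language.realAnExp (fun v => ∑ i ∈ s, g i v) := by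
  classical
  induction s using Finset.induction_on with
  | empty => simpa using (definableFun_const (α := α) 0)
  | insert a s ha ih =>
    have h := definableFun_add (hg a (Finset.mem_insert_self a s))
      (ih fun i hi => hg i (Finset.mem_insert_of_mem hi))
    simpa [Finset.sum_insert ha] using h

/-- A restricted analytic function symbol applied to a definable map of tuples is a definable
function of tuples. [folklore] -/
theorem definableFun_restrict {n : ℕ} (f : RestrictedAnalytic n) {G : (α → ℝ) → Fin n → ℝ}
    (hG : (univ : Set ℝ).DefinableMap Language.realAnExp G) :
    (univ : Set ℝ).DefinableFun Language.realAnExp (fun v => f.restrict (G v)) := by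
  have hF : (univ : Set ℝ).DefinableFun Language.realAnExp
      (Structure.funMap (L := Language.realAnExp) (M := ℝ) (realAnExpFunc.an f)) :=
    (Set.DefinableFun.fun_symbol (L := Language.realAnExp) (M := ℝ) (realAnExpFunc.an f)).of_empty
  simpa using hF.comp hG

/-- `{v | g v < h v}` is definable for definable `g`, `h`; the strict order of `ℝ` is definable in
the ordered structure `ℝ_an,exp` by `definable_lt_of_orderedStructure`. [folklore] -/
theorem definable_setOf_lt' {g h : (α → ℝ) → ℝ}
    (hg : (univ : Set ℝ).DefinableFun Language.realAnExp g)
    (hh : (univ : Set ℝ).DefinableFun Language.realAnExp h) :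
    (univ : Set ℝ).Definable Language.realAnExp {v : α → ℝ | g v < h v} :=
  definable_setOf_lt definable_lt_of_orderedStructure hg hh

/-- `{v | g v ≤ h v}` is definable for definable `g`, `h`. [folklore] -/
theorem definable_setOf_le' {g h : (α → ℝ) → ℝ}
    (hg : (univ : Set ℝ).DefinableFun Language.realAnExp g)
    (hh : (univ : Set ℝ).DefinableFun Language.realAnExp h) :
    (univ : Set ℝ).Definable Language.realAnExp {v : α → ℝ | g v ≤ h v} :=
  definable_setOf_le definable_lt_of_orderedStructure hg hh

end DefinableFun

/-! ### Boxes -/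

section Boxes

variable {α : Type*} [Fintype α]

/-- Membership of a sub-tuple in a closed box with real corners is a definable condition:
`{v | (fun i => v (τ i)) ∈ Icc a b}`. [folklore] -/
theorem definable_setOf_comp_mem_Icc {γ : Type*} (τ : α → γ) (a b : α → ℝ) :
    (univ : Set ℝ).Definable Language.realAnExp {v : γ → ℝ | (fun i => v (τ i)) ∈ Icc a b} := by
  have key : {v : γ → ℝ | (fun i => v (τ i)) ∈ Icc a b} =
      {v : γ → ℝ | ∀ i : α, a i ≤ v (τ i) ∧ v (τ i) ≤ b i} := by
    ext v
    simp only [mem_setOf_eq, mem_Icc, Pi.le_def]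
    exact ⟨fun h i => ⟨h.1 i, h.2 i⟩, fun h => ⟨fun i => (h i).1, fun i => (h i).2⟩⟩
  rw [key]
  exact definable_setOf_forall_index fun i => definable_setOf_and
    (definable_setOf_le' (definableFun_const _) (definableFun_proj _))
    (definable_setOf_le' (definableFun_proj _) (definableFun_const _))

/-- Closed boxes with real corners are definable. [folklore] -/
theorem definable_Icc (a b : α → ℝ) :
    (univ : Set ℝ).Definable Language.realAnExp (Icc a b : Set (α → ℝ)) := by
  have h := definable_setOf_comp_mem_Icc (id : α → α) a b
  have key : {v : α → ℝ | (fun i => v (id i)) ∈ Icc a b} = Icc a b := by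
    ext v
    exact Iff.rfl
  rwa [key] at h

end Boxes

/-! ### Graphs of analytic functions over boxes -/

section Graphs

variable {n : ℕ}

/-- The graph of `f : ℝⁿ → ℝ` over `D ⊆ ℝⁿ`, as a subset of `ℝⁿ⁺¹` (last coordinate = value). We do
not introduce a definition; this abbreviation-free spelling `{v | init v ∈ D ∧ v last = f (init v)}`
is used throughout. The graph over a union is the union of the graphs. [folklore] -/
theorem setOf_graphOn_union (f : (Fin n → ℝ) → ℝ) (D₁ D₂ : Set (Fin n → ℝ)) :
    {v : Fin (n + 1) → ℝ | Fin.init v ∈ D₁ ∪ D₂ ∧ v (Fin.last n) = f (Fin.init v)} =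
      {v : Fin (n + 1) → ℝ | Fin.init v ∈ D₁ ∧ v (Fin.last n) = f (Fin.init v)} ∪
        {v : Fin (n + 1) → ℝ | Fin.init v ∈ D₂ ∧ v (Fin.last n) = f (Fin.init v)} := by
  ext v
  simp only [mem_setOf_eq, mem_union]
  tauto

/-- **The graph of an analytic function over a closed box inside its domain of analyticity is
definable in `ℝ_an,exp`.** For `a < b` (coordinatewise), `Icc a b ⊆ U`, `U` open and `f` analytic on
`U`: after the affine change of variables `u ↦ a + u (b - a)` of `[0,1]ⁿ` onto `[a,b]`, `f` becomes a
restricted analytic function `g`, and on the box `f(x) = g|_{[0,1]ⁿ}((x - a)/(b - a))`, an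
`ℝ_an,exp`-term with real parameters. [cite: Pila2022, 8.21] -/
theorem definable_graphOn_Icc {f : (Fin n → ℝ) → ℝ} {a b : Fin n → ℝ} (hab : ∀ i, a i < b i)
    {U : Set (Fin n → ℝ)} (hU : IsOpen U) (hsub : Icc a b ⊆ U) (hf : AnalyticOnNhd ℝ f U) :
    (univ : Set ℝ).Definable Language.realAnExp
      {v : Fin (n + 1) → ℝ | Fin.init v ∈ Icc a b ∧ v (Fin.last n) = f (Fin.init v)} := by
  -- the affine reparametrisation and its inverse
  set A : (Fin n → ℝ) → (Fin n → ℝ) := fun u i => a i + u i * (b i - a i) with hA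
  set B : (Fin n → ℝ) → (Fin n → ℝ) := fun x i => (x i - a i) * (b i - a i)⁻¹ with hB
  have hba : ∀ i, b i - a i ≠ 0 := fun i => (sub_pos.2 (hab i)).ne'
  have hAB : ∀ x, A (B x) = x := by
    intro x
    funext i
    simp only [hA, hB]
    field_simp [hba i]
    ring
  have hAa : AnalyticOnNhd ℝ A univ := by
    intro u _
    refine (analyticAt_pi_iff (𝕜 := ℝ)).2 fun i => ?_  -- componentwise
    have hproj : AnalyticAt ℝ (fun u : Fin n → ℝ => u i) u :=
      (ContinuousLinearMap.proj i : (Fin n → ℝ) →L[ℝ] ℝ).analyticAt u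
    exact analyticAt_const.add (hproj.mul analyticAt_const)
  have hAc : Continuous A := hAa.continuous
  have hAmaps : ∀ u ∈ Icc (0 : Fin n → ℝ) 1, A u ∈ Icc a b := by
    intro u hu
    rw [mem_Icc] at hu ⊢
    constructor
    · intro i
      have h0 : 0 ≤ u i := hu.1 i
      have : 0 ≤ u i * (b i - a i) := mul_nonneg h0 (sub_pos.2 (hab i)).le
      simp only [hA]
      linarith
    · intro i
      have h1 : u i ≤ 1 := hu.2 i
      have : u i * (b i - a i) ≤ 1 * (b i - a i) :=
        mul_le_mul_of_nonneg_right h1 (sub_pos.2 (hab i)).le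
      simp only [hA]
      linarith
  have hBmaps : ∀ x ∈ Icc a b, B x ∈ Icc (0 : Fin n → ℝ) 1 := by
    intro x hx
    rw [mem_Icc] at hx ⊢
    constructor
    · intro i
      have : 0 ≤ x i - a i := sub_nonneg.2 (hx.1 i)
      exact mul_nonneg this (inv_nonneg.2 (sub_pos.2 (hab i)).le)
    · intro i
      have h1 : x i - a i ≤ b i - a i := sub_le_sub_right (hx.2 i) _
      have hpos : 0 < b i - a i := sub_pos.2 (hab i)
      calc (x i - a i) * (b i - a i)⁻¹ ≤ (b i - a i) * (b i - a i)⁻¹ :=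
            mul_le_mul_of_nonneg_right h1 (inv_nonneg.2 hpos.le)
        _ = 1 := mul_inv_cancel₀ hpos.ne'
  -- the restricted analytic function `g = f ∘ A`
  have hgU : IsOpen (A ⁻¹' U) := hU.preimage hAc
  have hg : AnalyticOnNhd ℝ (f ∘ A) (A ⁻¹' U) := fun u hu => (hf (A u) hu).comp (hAa u (mem_univ u))
  let g : RestrictedAnalytic n :=
    ⟨f ∘ A, A ⁻¹' U, hgU, fun u hu => hsub (hAmaps u hu), hg⟩
  -- definability of `v ↦ g|((init v - a)/(b - a))`
  have hBdef : (univ : Set ℝ).DefinableMap Language.realAnExp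
      (fun v : Fin (n + 1) → ℝ => B (Fin.init v)) := by
    intro i
    simp only [hB, Fin.init]
    exact definableFun_mul (definableFun_sub (definableFun_proj _) (definableFun_const _))
      (definableFun_const _)
  have hGdef : (univ : Set ℝ).DefinableFun Language.realAnExp
      (fun v : Fin (n + 1) → ℝ => g.restrict (B (Fin.init v))) :=
    definableFun_restrict g hBdef
  -- the definable description of the graph
  have key : {v : Fin (n + 1) → ℝ | Fin.init v ∈ Icc a b ∧ v (Fin.last n) = f (Fin.init v)} =
      {v : Fin (n + 1) → ℝ | (fun i => v (Fin.castSucc i)) ∈ Icc a b ∧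
        v (Fin.last n) = g.restrict (B (Fin.init v))} := by
    ext v
    simp only [mem_setOf_eq]
    have hinit : Fin.init v = fun i => v (Fin.castSucc i) := rfl
    constructor
    · rintro ⟨hv, hval⟩
      refine ⟨hinit ▸ hv, ?_⟩
      rw [hval, g.restrict_of_mem (hBmaps _ hv)]
      show f (Fin.init v) = (f ∘ A) (B (Fin.init v))
      rw [Function.comp_apply, hAB]
    · rintro ⟨hv, hval⟩
      have hv' : Fin.init v ∈ Icc a b := hinit ▸ hv
      refine ⟨hv', ?_⟩
      rw [hval, g.restrict_of_mem (hBmaps _ hv')]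
      show (f ∘ A) (B (Fin.init v)) = f (Fin.init v)
      rw [Function.comp_apply, hAB]
  rw [key]
  exact definable_setOf_and (definable_setOf_comp_mem_Icc Fin.castSucc a b)
    (definable_setOf_eq' (definableFun_proj _) hGdef)

/-- Finite unions over a `Finset` of sets each of which is definable (hypothesis only on the
members of the `Finset`). [folklore] -/
theorem definable_biUnion_finset' {ι β : Type*} {s : Finset ι} {t : ι → Set (β → ℝ)}
    (ht : ∀ i ∈ s, (univ : Set ℝ).Definable Language.realAnExp (t i)) :
    (univ : Set ℝ).Definable Language.realAnExp (⋃ i ∈ s, t i) := by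
  classical
  induction s using Finset.induction_on with
  | empty => simp
  | insert a s ha ih =>
    rw [Finset.set_biUnion_insert]
    exact (ht a (Finset.mem_insert_self a s)).union
      (ih fun i hi => ht i (Finset.mem_insert_of_mem hi))

/-- Inside an open set, every point has a closed cube neighbourhood `[x - r, x + r]`, `r > 0`,
contained in the open set and containing the open ball `B(x, r)` (sup metric). [folklore] -/
theorem exists_Icc_subset_of_isOpen {U : Set (Fin n → ℝ)} (hU : IsOpen U) {x : Fin n → ℝ}
    (hx : x ∈ U) : ∃ r : ℝ, 0 < r ∧ Icc (x - fun _ => r) (x + fun _ => r) ⊆ U ∧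
      Metric.ball x r ⊆ Icc (x - fun _ => r) (x + fun _ => r) := by
  obtain ⟨ε, hε, hball⟩ := Metric.isOpen_iff.1 hU x hx
  refine ⟨ε / 2, half_pos hε, fun y hy => hball ?_, fun y hy => ?_⟩
  · rw [Metric.mem_ball, dist_pi_lt_iff hε]
    intro i
    rw [mem_Icc] at hy
    have h1 := hy.1 i
    have h2 := hy.2 i
    simp only [Pi.sub_apply, Pi.add_apply] at h1 h2
    rw [Real.dist_eq, abs_lt]
    constructor <;> linarith
  · rw [Metric.mem_ball, dist_pi_lt_iff (half_pos hε)] at hy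
    rw [mem_Icc]
    constructor
    · intro i
      have h := hy i
      rw [Real.dist_eq, abs_lt] at h
      simp only [Pi.sub_apply]
      linarith [h.1]
    · intro i
      have h := hy i
      rw [Real.dist_eq, abs_lt] at h
      simp only [Pi.add_apply]
      linarith [h.2]

/-- **Finitely many closed boxes around a compact subset of an open set, over which every analytic
function on the open set has a definable graph.** For `C ⊆ U`, `C` compact, `U` open in `ℝⁿ`, there is
a compact `ℝ_an,exp`-definable `D` (a finite union of closed cubes contained in `U`) with
`C ⊆ D ⊆ U` such that the graph over `D` of every `f` analytic on `U` is definable.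
[cite: Pila2022, 8.21] -/
theorem exists_boxes_definable_graphOn {U : Set (Fin n → ℝ)} (hU : IsOpen U) {C : Set (Fin n → ℝ)}
    (hC : IsCompact C) (hCU : C ⊆ U) :
    ∃ D : Set (Fin n → ℝ), C ⊆ D ∧ D ⊆ U ∧ IsCompact D ∧
      (univ : Set ℝ).Definable Language.realAnExp D ∧
      ∀ f : (Fin n → ℝ) → ℝ, AnalyticOnNhd ℝ f U →
        (univ : Set ℝ).Definable Language.realAnExp
          {v : Fin (n + 1) → ℝ | Fin.init v ∈ D ∧ v (Fin.last n) = f (Fin.init v)} := by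
  classical
  have hr : ∀ x ∈ U, ∃ r : ℝ, 0 < r ∧ Icc (x - fun _ => r) (x + fun _ => r) ⊆ U ∧
      Metric.ball x r ⊆ Icc (x - fun _ => r) (x + fun _ => r) := fun x hx =>
    exists_Icc_subset_of_isOpen hU hx
  choose! r hr0 hrU hrball using hr
  set box : (Fin n → ℝ) → Set (Fin n → ℝ) := fun x => Icc (x - fun _ => r x) (x + fun _ => r x)
    with hbox
  have hcover : C ⊆ ⋃ x ∈ C, Metric.ball x (r x) := fun x hx =>
    mem_iUnion₂.2 ⟨x, hx, Metric.mem_ball_self (hr0 x (hCU hx))⟩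
  obtain ⟨b, hbC, hbfin, hbcover⟩ :=
    hC.elim_finite_subcover_image (fun x _ => Metric.isOpen_ball) hcover
  refine ⟨⋃ x ∈ hbfin.toFinset, box x, ?_, ?_, ?_, ?_, ?_⟩
  · intro y hy
    obtain ⟨x, hx, hyx⟩ := mem_iUnion₂.1 (hbcover hy)
    exact mem_iUnion₂.2 ⟨x, hbfin.mem_toFinset.2 hx, hrball x (hCU (hbC hx)) hyx⟩
  · intro y hy
    obtain ⟨x, hx, hyx⟩ := mem_iUnion₂.1 hy
    exact hrU x (hCU (hbC (hbfin.mem_toFinset.1 hx))) hyx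
  · exact hbfin.toFinset.finite_toSet.isCompact_biUnion fun x _ => isCompact_Icc
  · exact definable_biUnion_finset' fun x _ => definable_Icc _ _
  · intro f hf
    have key : {v : Fin (n + 1) → ℝ | Fin.init v ∈ (⋃ x ∈ hbfin.toFinset, box x) ∧
        v (Fin.last n) = f (Fin.init v)} =
        ⋃ x ∈ hbfin.toFinset, {v : Fin (n + 1) → ℝ | Fin.init v ∈ box x ∧
          v (Fin.last n) = f (Fin.init v)} := by
      ext v
      simp only [mem_setOf_eq, mem_iUnion, exists_prop]
      constructor
      · rintro ⟨⟨x, hx, hv⟩, hval⟩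
        exact ⟨x, hx, hv, hval⟩
      · rintro ⟨x, hx, hv, hval⟩
        exact ⟨⟨x, hx, hv⟩, hval⟩
    rw [key]
    refine definable_biUnion_finset' fun x hx => ?_
    have hxU : x ∈ U := hCU (hbC (hbfin.mem_toFinset.1 hx))
    exact definable_graphOn_Icc (fun i => by simp only [Pi.sub_apply, Pi.add_apply]; linarith [hr0 x hxU])
      hU (hrU x hxU) hf

/-- From a definable graph over `D` to definable superlevel sets over `D`:
`{ξ ∈ D | 0 ≤ g ξ}` is definable. [cite: Dries1998, Ch. 1 (2.3)] -/
theorem definable_setOf_mem_and_nonneg {g : (Fin n → ℝ) → ℝ} {D : Set (Fin n → ℝ)}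
    (hG : (univ : Set ℝ).Definable Language.realAnExp
      {v : Fin (n + 1) → ℝ | Fin.init v ∈ D ∧ v (Fin.last n) = g (Fin.init v)}) :
    (univ : Set ℝ).Definable Language.realAnExp {ξ : Fin n → ℝ | ξ ∈ D ∧ 0 ≤ g ξ} := by
  have key : {ξ : Fin n → ℝ | ξ ∈ D ∧ 0 ≤ g ξ} = {ξ : Fin n → ℝ | ∃ y : ℝ,
      (Fin.snoc ξ y : Fin (n + 1) → ℝ) ∈
        {v : Fin (n + 1) → ℝ | Fin.init v ∈ D ∧ v (Fin.last n) = g (Fin.init v)} ∧ 0 ≤ y} := by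
    ext ξ
    simp only [mem_setOf_eq, Fin.init_snoc, Fin.snoc_last]
    constructor
    · rintro ⟨hξ, hg⟩
      exact ⟨g ξ, ⟨hξ, rfl⟩, hg⟩
    · rintro ⟨y, ⟨hξ, rfl⟩, hy⟩
      exact ⟨hξ, hy⟩
  rw [key]
  refine definable_setOf_exists (P := fun (ξ : Fin n → ℝ) (y : ℝ) =>
    (Fin.snoc ξ y : Fin (n + 1) → ℝ) ∈
      {v : Fin (n + 1) → ℝ | Fin.init v ∈ D ∧ v (Fin.last n) = g (Fin.init v)} ∧ 0 ≤ y) ?_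
  refine definable_setOf_and ?_ (definable_setOf_le' (definableFun_const _) (definableFun_proj _))
  exact definable_setOf_snoc_mem' hG Sum.inl (Sum.inr ())

/-- From definable graphs of the components over `D` (and `D` definable) to the definable graph of
a vector-valued map over `D`, in `Fin n ⊕ Fin k` coordinates:
`{w | w|_inl ∈ D ∧ ∀ j, w (inr j) = h (w|_inl) j}`. [cite: Dries1998, Ch. 1 (2.3)] -/
theorem definable_vectorGraphOn {k : ℕ} {h : (Fin n → ℝ) → (Fin k → ℝ)} {D : Set (Fin n → ℝ)}
    (hD : (univ : Set ℝ).Definable Language.realAnExp D)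
    (hG : ∀ j : Fin k, (univ : Set ℝ).Definable Language.realAnExp
      {v : Fin (n + 1) → ℝ | Fin.init v ∈ D ∧ v (Fin.last n) = h (Fin.init v) j}) :
    (univ : Set ℝ).Definable Language.realAnExp
      {w : Fin n ⊕ Fin k → ℝ | (fun i => w (Sum.inl i)) ∈ D ∧
        ∀ j, w (Sum.inr j) = h (fun i => w (Sum.inl i)) j} := by
  have key : {w : Fin n ⊕ Fin k → ℝ | (fun i => w (Sum.inl i)) ∈ D ∧
      ∀ j, w (Sum.inr j) = h (fun i => w (Sum.inl i)) j} =
      {w : Fin n ⊕ Fin k → ℝ | (w ∘ Sum.inl) ∈ D ∧ ∀ j : Fin k,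
        (Fin.snoc (fun i => w (Sum.inl i)) (w (Sum.inr j)) : Fin (n + 1) → ℝ) ∈
          {v : Fin (n + 1) → ℝ | Fin.init v ∈ D ∧ v (Fin.last n) = h (Fin.init v) j}} := by
    ext w
    simp only [mem_setOf_eq, Fin.init_snoc, Fin.snoc_last]
    constructor
    · rintro ⟨hw, hval⟩
      exact ⟨hw, fun j => ⟨hw, hval j⟩⟩
    · rintro ⟨hw, hval⟩
      exact ⟨hw, fun j => (hval j).2⟩
  rw [key]
  refine definable_setOf_and (definable_setOf_comp_mem hD Sum.inl) ?_
  exact definable_setOf_forall_index fun j => definable_setOf_snoc_mem' (hG j) Sum.inl (Sum.inr j)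

end Graphs

end Language.realAnExp

/-! ### Globalisation of Hironaka's local Boolean combinations -/

section Globalisation

variable {n : ℕ}

open Literature.Geometry.Manifold

/-- **From local Boolean combinations to global definability.** If `A ⊆ K` with `K` compact, `A`
lies locally (at every point, on some open neighbourhood `U`) in the Boolean algebra generated by
admissible generators over `U`, and every point of every open `U` has a definable neighbourhood
`V ⊆ U` on which all admissible generators over `U` have definable trace, then `A` is definable:
the trace of a Boolean combination is the Boolean combination of the traces, and finitely many such
`V` cover `K ⊇ A`. [cite: Dries1998, Ch. 1 (2.3)] -/
theorem _root_.Literature.Geometry.Manifold.IsLocallyInBooleanClosure.definable_of_local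
    {gen : Set (Fin n → ℝ) → Set (Set (Fin n → ℝ))} {A K : Set (Fin n → ℝ)}
    (hA : IsLocallyInBooleanClosure gen A) (hK : IsCompact K) (hAK : A ⊆ K)
    (hloc : ∀ (x : Fin n → ℝ) (U : Set (Fin n → ℝ)), IsOpen U → x ∈ U →
      ∃ V ∈ 𝓝 x, V ⊆ U ∧ (univ : Set ℝ).Definable Language.realAnExp V ∧
        ∀ s ∈ gen U, (univ : Set ℝ).Definable Language.realAnExp (s ∩ V)) :
    (univ : Set ℝ).Definable Language.realAnExp A := by
  classical
  -- at every point, a neighbourhood on which `A` has definable trace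
  have hpt : ∀ x : Fin n → ℝ, ∃ V ∈ 𝓝 x, (univ : Set ℝ).Definable Language.realAnExp (A ∩ V) := by
    intro x
    obtain ⟨U, hUo, hxU, S, _, hSg, B, hB, hAB⟩ := hA x
    obtain ⟨V, hV, hVU, hVdef, hgenV⟩ := hloc x U hUo hxU
    have hBV' : ∀ B' : Set (Fin n → ℝ), B' ∈ BooleanSubalgebra.closure S →
        (univ : Set ℝ).Definable Language.realAnExp (B' ∩ V) := by
      intro B' hB'
      induction hB' using BooleanSubalgebra.closure_bot_sup_induction with
      | mem s hs => exact hgenV s (hSg hs)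
      | bot => simp
      | sup s _ t _ hs ht =>
        have h := hs.union ht
        rwa [← union_inter_distrib_right] at h
      | compl s _ hs =>
        have h := hVdef.sdiff hs
        have heq : V \ (s ∩ V) = sᶜ ∩ V := by
          ext ξ
          simp only [Set.mem_sdiff, mem_inter_iff, mem_compl_iff]
          tauto
        rwa [heq] at h
    have hBV : (univ : Set ℝ).Definable Language.realAnExp (B ∩ V) := hBV' B hB
    refine ⟨V, hV, ?_⟩
    have hAV : A ∩ V = B ∩ V := by
      have h1 : A ∩ V = (A ∩ U) ∩ V := by
        rw [inter_assoc, inter_eq_right.2 hVU]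
      rw [h1, hAB, inter_assoc, inter_eq_right.2 hVU]
    rw [hAV]
    exact hBV
  choose V hV hVdef using hpt
  -- finitely many of them cover `K`
  have hcover : K ⊆ ⋃ x ∈ K, interior (V x) := fun x hx =>
    mem_iUnion₂.2 ⟨x, hx, mem_interior_iff_mem_nhds.2 (hV x)⟩
  obtain ⟨b, -, hbfin, hbcover⟩ :=
    hK.elim_finite_subcover_image (fun x _ => isOpen_interior) hcover
  have hAeq : A = ⋃ x ∈ hbfin.toFinset, (A ∩ V x) := by
    apply Subset.antisymm
    · intro a ha
      obtain ⟨x, hx, hax⟩ := mem_iUnion₂.1 (hbcover (hAK ha))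
      exact mem_iUnion₂.2 ⟨x, hbfin.mem_toFinset.2 hx, ha, interior_subset hax⟩
    · exact iUnion₂_subset fun x _ => inter_subset_left
  rw [hAeq]
  exact Language.realAnExp.definable_biUnion_finset' fun x _ => hVdef x

end Globalisation

/-! ### Bounded semi-analytic and subanalytic sets are definable -/

section Subanalytic

variable {n : ℕ}

open Literature.Geometry.Manifold

/-- **Bounded semi-analytic subsets of `ℝⁿ` are definable in `ℝ_an,exp`** (they are globally
subanalytic, Pila 2022, 8.21): near every point, on a small closed cube inside the neighbourhood of
Hironaka's Def. 3.1, each generator `{f ≥ 0}` has definable trace (`f` is restricted analytic on the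
cube), and the cube traces globalise over the compact closure. [cite: Pila2022, 8.21] -/
theorem _root_.Literature.Geometry.Manifold.IsSemianalytic.definable_realAnExp {A : Set (Fin n → ℝ)}
    (hA : IsSemianalytic A) (hb : Bornology.IsBounded A) :
    (univ : Set ℝ).Definable Language.realAnExp A := by
  refine hA.definable_of_local hb.isCompact_closure subset_closure fun x U hUo hxU => ?_
  obtain ⟨r, hr0, hrU, hball⟩ := Language.realAnExp.exists_Icc_subset_of_isOpen hUo hxU
  refine ⟨Icc (x - fun _ => r) (x + fun _ => r), mem_of_superset (Metric.ball_mem_nhds x hr0) hball,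
    hrU, Language.realAnExp.definable_Icc _ _, ?_⟩
  rintro s ⟨f, hf, rfl⟩
  have hG := Language.realAnExp.definable_graphOn_Icc
    (fun i => by simp only [Pi.sub_apply, Pi.add_apply]; linarith) hUo hrU hf
  have h := Language.realAnExp.definable_setOf_mem_and_nonneg hG
  have heq : {ξ : Fin n → ℝ | 0 ≤ f ξ} ∩ Icc (x - fun _ => r) (x + fun _ => r) =
      {ξ : Fin n → ℝ | ξ ∈ Icc (x - fun _ => r) (x + fun _ => r) ∧ 0 ≤ f ξ} := by
    ext ξ
    simp only [mem_inter_iff, mem_setOf_eq]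
    tauto
  rw [heq]
  exact h

/-- **Images of bounded semi-analytic sets under entire analytic maps are definable in `ℝ_an,exp`**
(Hironaka's generators of Def. 3.3): `f(B) = {y | ∃ u ∈ B, y = f u}` with `B` definable and the graph
of `f` over a cube containing `B` definable. [cite: Pila2022, 8.21] -/
theorem definable_image_of_isSemianalytic {m : ℕ} {B : Set (Fin m → ℝ)} (hB : IsSemianalytic B)
    (hBb : Bornology.IsBounded B) {f : (Fin m → ℝ) → (Fin n → ℝ)} (hf : AnalyticOnNhd ℝ f univ) :
    (univ : Set ℝ).Definable Language.realAnExp (f '' B) := by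
  have hBdef := hB.definable_realAnExp hBb
  -- a cube containing `B`
  obtain ⟨R, hR⟩ := hBb.subset_closedBall 0
  set Q : Set (Fin m → ℝ) := Icc (fun _ => -(|R| + 1)) (fun _ => |R| + 1) with hQ
  have hBQ : B ⊆ Q := by
    intro u hu
    have hu' := hR hu
    rw [Metric.mem_closedBall] at hu'
    have hR0 : 0 ≤ R := dist_nonneg.trans hu'
    rw [dist_pi_le_iff hR0] at hu'
    rw [hQ, mem_Icc]
    constructor
    · intro i
      have h := hu' i
      simp only [Pi.zero_apply, Real.dist_0_eq_abs, abs_le] at h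
      dsimp only
      linarith [h.1, le_abs_self R]
    · intro i
      have h := hu' i
      simp only [Pi.zero_apply, Real.dist_0_eq_abs, abs_le] at h
      dsimp only
      linarith [h.2, le_abs_self R]
  -- graphs of the components over `Q`
  have hGj : ∀ j : Fin n, (univ : Set ℝ).Definable Language.realAnExp
      {v : Fin (m + 1) → ℝ | Fin.init v ∈ Q ∧ v (Fin.last m) = f (Fin.init v) j} := by
    intro j
    have hfj : AnalyticOnNhd ℝ (fun u => f u j) univ := fun u hu =>
      ((ContinuousLinearMap.proj j : (Fin n → ℝ) →L[ℝ] ℝ).analyticAt (f u)).comp (hf u hu)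
    have hpos : (0 : ℝ) < |R| + 1 := by positivity
    exact Language.realAnExp.definable_graphOn_Icc (f := fun u => f u j)
      (fun i => by linarith) isOpen_univ (subset_univ _) hfj
  have hQdef : (univ : Set ℝ).Definable Language.realAnExp Q := by
    rw [hQ]
    exact Language.realAnExp.definable_Icc _ _
  have hV := Language.realAnExp.definable_vectorGraphOn hQdef hGj
  -- `f '' B` as a projection
  have key : f '' B = {y : Fin n → ℝ | ∃ u : Fin m → ℝ, u ∈ B ∧
      (Sum.elim u y : Fin m ⊕ Fin n → ℝ) ∈ {w : Fin m ⊕ Fin n → ℝ | (fun i => w (Sum.inl i)) ∈ Q ∧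
        ∀ j, w (Sum.inr j) = f (fun i => w (Sum.inl i)) j}} := by
    ext y
    simp only [mem_image, mem_setOf_eq, Sum.elim_inl, Sum.elim_inr]
    constructor
    · rintro ⟨u, hu, rfl⟩
      exact ⟨u, hu, hBQ hu, fun j => rfl⟩
    · rintro ⟨u, hu, -, hval⟩
      exact ⟨u, hu, (funext hval).symm⟩
  rw [key]
  refine definable_setOf_exists_fin (P := fun (y : Fin n → ℝ) (u : Fin m → ℝ) => u ∈ B ∧
    (Sum.elim u y : Fin m ⊕ Fin n → ℝ) ∈ {w : Fin m ⊕ Fin n → ℝ | (fun i => w (Sum.inl i)) ∈ Q ∧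
      ∀ j, w (Sum.inr j) = f (fun i => w (Sum.inl i)) j}) ?_
  refine definable_setOf_and (definable_setOf_comp_mem hBdef Sum.inr) ?_
  have h := hV.preimage_comp (Sum.swap : Fin m ⊕ Fin n → Fin n ⊕ Fin m)
  convert h using 1
  ext w
  simp only [mem_setOf_eq, mem_preimage, Function.comp_apply, Sum.swap_inl, Sum.swap_inr,
    Sum.elim_inl, Sum.elim_inr]

/-- **Bounded subanalytic subsets of `ℝⁿ` are definable in `ℝ_an,exp`** (globally subanalytic
sets are `ℝ_an`-definable, Pila 2022, 8.21 — the elementary direction): Hironaka's generators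
`f(B)` (Def. 3.3) are definable outright (`definable_image_of_isSemianalytic`), and the local Boolean
combinations globalise over the compact closure. [cite: Pila2022, 8.21] -/
theorem _root_.Literature.Geometry.Manifold.IsSubanalytic.definable_realAnExp {A : Set (Fin n → ℝ)}
    (hA : IsSubanalytic A) (hb : Bornology.IsBounded A) :
    (univ : Set ℝ).Definable Language.realAnExp A := by
  refine hA.definable_of_local hb.isCompact_closure subset_closure fun x U hUo hxU => ?_
  obtain ⟨r, hr0, hrU, hball⟩ := Language.realAnExp.exists_Icc_subset_of_isOpen hUo hxU
  refine ⟨Icc (x - fun _ => r) (x + fun _ => r), mem_of_superset (Metric.ball_mem_nhds x hr0) hball,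
    hrU, Language.realAnExp.definable_Icc _ _, ?_⟩
  rintro s ⟨m, B, f, hB, hBb, hf, rfl⟩
  exact (definable_image_of_isSemianalytic hB hBb hf).inter (Language.realAnExp.definable_Icc _ _)

/-- The same for a bounded subanalytic subset of any finite-dimensional real normed space `E`, read
in coordinates through a linear isomorphism `e : E ≃ ℝⁿ` (subanalyticity and boundedness are
transported by `e`). [cite: Pila2022, 8.21] -/
theorem _root_.Literature.Geometry.Manifold.IsSubanalytic.definable_realAnExp_image
    {E : Type*} [NormedAddCommGroup E] [NormedSpace ℝ E] {A : Set E}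
    (hA : IsSubanalytic A) (hb : Bornology.IsBounded A) (e : E ≃L[ℝ] (Fin n → ℝ)) :
    (univ : Set ℝ).Definable Language.realAnExp (e '' A) := by
  refine (hA.image_equiv e).definable_realAnExp ?_
  exact e.lipschitz.isBounded_image hb

end Subanalytic

end Literature.ModelTheory.ExponentialFields
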